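import Summits.RiemannHypothesis.RiemannHypothesis.Theorems.ZetaStringKernelOfWeilOnComb
import Summits.RiemannHypothesis.RiemannHypothesis.Theorems.ZetaStringKreinWindow
import Mathlib.Topology.UniformSpace.HeineCantor
import HarnessLib

/-!
# Positivity of a hermitian form on mean-zero test functions ⟹ positivity of its continuous kernel on the open window (RH-FREE glue, generic kernel)

LINE 1 — LABEL: RH-FREE glue about an ARBITRARY jointly continuous real kernel `K(t,u)` (no property of `ζ` is used;
nothing here bears on the truth of RH). bears_on: LADDER-RH B-D → B-P(P1) (cell rh-dbr: the cross-column dictionary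
«semi-local Weil threshold `a*(S)` (column WEIL) ↔ Kreĭn-kernel depth `ℓ*(P) = 2a*` (column DBR)», ET6 / TARGET-v7 §K.2,
XCOL note 2026-08-26). WHAT THIS IS NOT: not progress toward RH; no positivity of any arithmetic kernel is asserted.

Kernel-generic form of the mollified-comb argument of `Theorems/ZetaStringKernelOfWeilOn{Comb,}.lean` (there hard-wired
to `G = zetaScrewKernel`; the comb lemmas `KernelOfWeilOn.comb`, `comb_mem_screwTestC0`, … are imported from it):
the inner integral `∫_{[−a,a]} K(t,u) g(u) du`, the double integral `∫_{[−a,a]}(∫_{[−a,a]} K g) h` and their bilinearity (no new definitions); `re_setIntegral_setIntegral_ofReal` (real weights);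
`sum_sum_mul_mul_nonneg_of_forall_comb` — **if `0 ≤ ∫∫ K(t,u) φ(u) φ(t)` for every real `φ ∈ 𝔈₀(a)`, then
`0 ≤ Σᵢⱼ wᵢ wⱼ K(sᵢ, sⱼ)` for every zero-sum system of real weights at points `|sᵢ| < a`** (combs `Σ wᵢ ρ_ε(· − sᵢ)`,
bilinear expansion, uniform continuity of `K` on `[−a,a]²`); and for Kreĭn kernels `K_F(t,u) = F(t) + F(u) − F(t − u)`
(`F` continuous, even, `F 0 = 0`) the zero-sum condition is removed by the node `0`:
`krein_psd_Ioo_of_forall_comb` / `krein_psd_Ioo_of_forall_re_nonneg : … → IsPosSemidefKernelOn (kreinKernel F) (Ioo (−a) a)`.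
References: M. Suzuki, J. Lond. Math. Soc. (2) 108 (2023) = arXiv:2206.03682, (1.4)–(1.5), (1.10)–(1.11); C. Berg,
J. P. R. Christensen, P. Ressel, *Harmonic Analysis on Semigroups* (1984), Ch. 3 §1 (augmentation by a base point).
-/
-- `Summit.RiemannHypothesis.RiemannHypothesis.…` duplicates `RiemannHypothesis` BY DESIGN (D-0017).
set_option linter.dupNamespace false

noncomputable section

open MeasureTheory Set Filter Metric
open scoped ComplexConjugate BigOperators Topology ContDiff

namespace Summit.RiemannHypothesis.RiemannHypothesis.Theorems.KreinFormComb

open Literature.NumberTheory.LFunctions Literature.Analysis.Complex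
open Summit.RiemannHypothesis.RiemannHypothesis.Theorems.KernelOfWeilOn
  (comb continuous_normed_sub continuous_comb normed_sub_eq_zero setIntegral_normed_sub comb_mem_screwTestC0)
open Summit.RiemannHypothesis.RiemannHypothesis.Theorems.ZetaStringArchWall
  (kreinKernel krein_psd_iff_real krein_sum_eq_cons)

variable {K : ℝ → ℝ → ℝ} {a : ℝ}

/-! ## §1 The real double integral of a continuous kernel and its bilinearity -/

/-- `K g` is continuous for continuous `g` and jointly continuous `K` (parametric integral over a compact set).
[folklore] -/
theorem continuous_innerIntK (hK : Continuous fun p : ℝ × ℝ => K p.1 p.2) {g : ℝ → ℝ} (hg : Continuous g) :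
    Continuous fun t => ∫ u in Icc (-a) a, K t u * g u := by
  have hc : Continuous (Function.uncurry fun t u : ℝ => K t u * g u) := hK.mul (hg.comp continuous_snd)
  exact continuous_parametric_integral_of_continuous hc isCompact_Icc

/-- `K` is additive in the weight. [folklore] -/
theorem innerIntK_add (hK : Continuous fun p : ℝ × ℝ => K p.1 p.2) {g₁ g₂ : ℝ → ℝ} (hg₁ : Continuous g₁)
    (hg₂ : Continuous g₂) (t : ℝ) :
    (∫ u in Icc (-a) a, K t u * (g₁ u + g₂ u)) =
      (∫ u in Icc (-a) a, K t u * g₁ u) + ∫ u in Icc (-a) a, K t u * g₂ u := by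
  have hKt : Continuous fun u => K t u := hK.comp (Continuous.prodMk_right t)
  have h1 : IntegrableOn (fun u => K t u * g₁ u) (Icc (-a) a) := (hKt.mul hg₁).integrableOn_Icc
  have h2 : IntegrableOn (fun u => K t u * g₂ u) (Icc (-a) a) := (hKt.mul hg₂).integrableOn_Icc
  rw [← integral_add h1 h2]
  refine setIntegral_congr_fun measurableSet_Icc fun u _ => ?_
  ring

/-- `K` is homogeneous in the weight. [folklore] -/
theorem innerIntK_const_mul (c : ℝ) (g : ℝ → ℝ) (t : ℝ) :
    (∫ u in Icc (-a) a, K t u * (c * g u)) = c * ∫ u in Icc (-a) a, K t u * g u := by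
  rw [← integral_const_mul]
  refine setIntegral_congr_fun measurableSet_Icc fun u _ => ?_
  ring

/-- `K` of a finite linear combination of continuous weights. [folklore] -/
theorem innerIntK_sum (hK : Continuous fun p : ℝ × ℝ => K p.1 p.2) {ι : Type*} (S : Finset ι) (c : ι → ℝ)
    {g : ι → ℝ → ℝ} (hg : ∀ i, Continuous (g i)) (t : ℝ) :
    (∫ u in Icc (-a) a, K t u * ∑ i ∈ S, c i * g i u) = ∑ i ∈ S, c i * ∫ u in Icc (-a) a, K t u * g i u := by
  classical
  induction S using Finset.induction_on with
  | empty => simp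
  | @insert j S hj ih =>
    simp only [Finset.sum_insert hj]
    have hc1 : Continuous fun u => c j * g j u := continuous_const.mul (hg j)
    have hc2 : Continuous fun u => ∑ i ∈ S, c i * g i u :=
      continuous_finsetSum S fun i _ => continuous_const.mul (hg i)
    rw [innerIntK_add hK hc1 hc2, innerIntK_const_mul, ih]

/-- The double integral is additive in the second weight. [folklore] -/
theorem doubleIntK_add_right (hK : Continuous fun p : ℝ × ℝ => K p.1 p.2) {g h₁ h₂ : ℝ → ℝ} (hg : Continuous g)
    (hh₁ : Continuous h₁) (hh₂ : Continuous h₂) :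
    (∫ t in Icc (-a) a, (∫ u in Icc (-a) a, K t u * g u) * (h₁ t + h₂ t)) =
      (∫ t in Icc (-a) a, (∫ u in Icc (-a) a, K t u * g u) * h₁ t) +
        ∫ t in Icc (-a) a, (∫ u in Icc (-a) a, K t u * g u) * h₂ t := by
  have hKg := continuous_innerIntK (a := a) hK hg
  have h1 : IntegrableOn (fun t => (∫ u in Icc (-a) a, K t u * g u) * h₁ t) (Icc (-a) a) :=
    (hKg.mul hh₁).integrableOn_Icc
  have h2 : IntegrableOn (fun t => (∫ u in Icc (-a) a, K t u * g u) * h₂ t) (Icc (-a) a) :=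
    (hKg.mul hh₂).integrableOn_Icc
  rw [← integral_add h1 h2]
  refine setIntegral_congr_fun measurableSet_Icc fun t _ => ?_
  ring

/-- The double integral is homogeneous in the second weight. [folklore] -/
theorem doubleIntK_const_mul_right (c : ℝ) (g h : ℝ → ℝ) :
    (∫ t in Icc (-a) a, (∫ u in Icc (-a) a, K t u * g u) * (c * h t)) =
      c * ∫ t in Icc (-a) a, (∫ u in Icc (-a) a, K t u * g u) * h t := by
  rw [← integral_const_mul]
  refine setIntegral_congr_fun measurableSet_Icc fun t _ => ?_
  ring

/-- The double integral of a finite linear combination in the second weight. [folklore] -/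
theorem doubleIntK_sum_right (hK : Continuous fun p : ℝ × ℝ => K p.1 p.2) {ι : Type*} (S : Finset ι)
    (c : ι → ℝ) {g : ℝ → ℝ} {h : ι → ℝ → ℝ} (hg : Continuous g) (hh : ∀ i, Continuous (h i)) :
    (∫ t in Icc (-a) a, (∫ u in Icc (-a) a, K t u * g u) * ∑ i ∈ S, c i * h i t) =
      ∑ i ∈ S, c i * ∫ t in Icc (-a) a, (∫ u in Icc (-a) a, K t u * g u) * h i t := by
  classical
  induction S using Finset.induction_on with
  | empty => simp
  | @insert j S hj ih =>
    simp only [Finset.sum_insert hj]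
    have hc1 : Continuous fun t => c j * h j t := continuous_const.mul (hh j)
    have hc2 : Continuous fun t => ∑ i ∈ S, c i * h i t :=
      continuous_finsetSum S fun i _ => continuous_const.mul (hh i)
    rw [doubleIntK_add_right hK hg hc1 hc2, doubleIntK_const_mul_right, ih]

/-- The double integral of a finite linear combination in the first weight. [folklore] -/
theorem doubleIntK_sum_left (hK : Continuous fun p : ℝ × ℝ => K p.1 p.2) {ι : Type*} (S : Finset ι)
    (c : ι → ℝ) {g : ι → ℝ → ℝ} {h : ℝ → ℝ} (hg : ∀ i, Continuous (g i)) (hh : Continuous h) :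
    (∫ t in Icc (-a) a, (∫ u in Icc (-a) a, K t u * ∑ i ∈ S, c i * g i u) * h t) =
      ∑ i ∈ S, c i * ∫ t in Icc (-a) a, (∫ u in Icc (-a) a, K t u * g i u) * h t := by
  simp_rw [innerIntK_sum hK S c hg, Finset.sum_mul]
  have hi : ∀ i ∈ S, IntegrableOn (fun t => c i * (∫ u in Icc (-a) a, K t u * g i u) * h t) (Icc (-a) a) :=
    fun i _ => ((continuous_const.mul (continuous_innerIntK hK (hg i))).mul hh).integrableOn_Icc
  rw [integral_finsetSum S hi]
  refine Finset.sum_congr rfl fun i _ => ?_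
  rw [← integral_const_mul]
  refine setIntegral_congr_fun measurableSet_Icc fun t _ => ?_
  ring

/-! ## §2 The complex hermitian form on real weights -/

/-- For a REAL weight `f` and a real kernel `K`,
`Re ∫_{(−a,a)}∫_{(−a,a)} K(t,u) f(u) conj f(t) du dt = ∫_{[−a,a]} (∫_{[−a,a]} K(t,u) f(u) du) f(t) dt` (the open
window may be replaced by the compact `[−a,a]`, null endpoints). [folklore] -/
theorem re_setIntegral_setIntegral_ofReal (f : ℝ → ℝ) :
    (∫ t in Ioo (-a) a, ∫ u in Ioo (-a) a, ((K t u : ℝ) : ℂ) * (f u : ℂ) * conj ((f t : ℂ))).re =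
      ∫ t in Icc (-a) a, (∫ u in Icc (-a) a, K t u * f u) * f t := by
  rw [setIntegral_congr_set Ioo_ae_eq_Icc]
  have hin : ∀ t, ∫ u in Ioo (-a) a, ((K t u : ℝ) : ℂ) * (f u : ℂ) * conj ((f t : ℂ)) =
      (((∫ u in Icc (-a) a, K t u * f u) * f t : ℝ) : ℂ) := by
    intro t
    rw [setIntegral_congr_set Ioo_ae_eq_Icc]
    have h1 : ∀ u, ((K t u : ℝ) : ℂ) * (f u : ℂ) * conj ((f t : ℂ)) = ((K t u * f u * f t : ℝ) : ℂ) := by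
      intro u
      rw [Complex.conj_ofReal]
      push_cast
      ring
    simp_rw [h1]
    rw [integral_complex_ofReal, ← integral_mul_const]
  simp_rw [hin]
  rw [integral_complex_ofReal, Complex.ofReal_re]

/-- The same for the Kreĭn kernel `K_F(t,u) = F(t) + F(u) − F(t−u)` of a real function (`kreinKernel F`). [folklore] -/
theorem re_setIntegral_setIntegral_kreinKernel_ofReal (F : ℝ → ℝ) (f : ℝ → ℝ) :
    (∫ t in Ioo (-a) a, ∫ u in Ioo (-a) a, kreinKernel F t u * (f u : ℂ) * conj ((f t : ℂ))).re =
      ∫ t in Icc (-a) a, (∫ u in Icc (-a) a, (F t + F u - F (t - u)) * f u) * f t :=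
  re_setIntegral_setIntegral_ofReal (K := fun t u => F t + F u - F (t - u)) f

/-! ## §3 The bump double integrals approximate point values of `K` -/

/-- Inner estimate: if `|K(t,u) − K(s,s')| ≤ η` for all `u` within `β.rOut` of `s'` (and the bump at `s'` fits in the
window), then `|(K ρ(· − s'))(t) − K(s,s')| ≤ η`. [folklore] -/
theorem abs_innerIntK_sub_le (hK : Continuous fun p : ℝ × ℝ => K p.1 p.2) (β : ContDiffBump (0 : ℝ))
    {s s' t η : ℝ} (hs' : |s'| + β.rOut ≤ a)
    (hKη : ∀ u, |u - s'| < β.rOut → |K t u - K s s'| ≤ η) :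
    |(∫ u in Icc (-a) a, K t u * β.normed volume (u - s')) - K s s'| ≤ η := by
  have hρc := continuous_normed_sub β s'
  have hone := setIntegral_normed_sub (a := a) β hs'
  have hKt : Continuous fun u => K t u := hK.comp (Continuous.prodMk_right t)
  have hI1 : IntegrableOn (fun u => K t u * β.normed volume (u - s')) (Icc (-a) a) :=
    (hKt.mul hρc).integrableOn_Icc
  have hI2 : IntegrableOn (fun u => K s s' * β.normed volume (u - s')) (Icc (-a) a) :=
    (continuous_const.mul hρc).integrableOn_Icc
  have hc : K s s' = ∫ u in Icc (-a) a, K s s' * β.normed volume (u - s') := by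
    rw [integral_const_mul, hone, mul_one]
  rw [hc, ← integral_sub hI1 hI2]
  have hbound : ∀ u, ‖K t u * β.normed volume (u - s') - K s s' * β.normed volume (u - s')‖ ≤
      η * β.normed volume (u - s') := by
    intro u
    rw [← sub_mul, norm_mul, Real.norm_eq_abs, Real.norm_eq_abs, abs_of_nonneg (β.nonneg_normed _)]
    by_cases hu : |u - s'| < β.rOut
    · exact mul_le_mul_of_nonneg_right (hKη u hu) (β.nonneg_normed _)
    · rw [normed_sub_eq_zero β (not_lt.1 hu), mul_zero, mul_zero]
  calc |∫ u in Icc (-a) a, (K t u * β.normed volume (u - s') - K s s' * β.normed volume (u - s'))|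
      ≤ ∫ u in Icc (-a) a, η * β.normed volume (u - s') := by
        rw [← Real.norm_eq_abs]
        exact norm_integral_le_of_norm_le ((continuous_const.mul hρc).integrableOn_Icc)
          (Eventually.of_forall hbound)
    _ = η := by rw [integral_const_mul, hone, mul_one]

/-- Outer estimate: if `|K(t,u) − K(s,s')| ≤ η` whenever `|t − s| < β.rOut` and `|u − s'| < β.rOut` (both bumps
inside the window), then `|D_K(ρ(· − s'), ρ(· − s)) − K(s,s')| ≤ η`. [folklore] -/
theorem abs_doubleIntK_sub_le (hK : Continuous fun p : ℝ × ℝ => K p.1 p.2) (β : ContDiffBump (0 : ℝ))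
    {s s' η : ℝ} (hs : |s| + β.rOut ≤ a) (hs' : |s'| + β.rOut ≤ a)
    (hKη : ∀ t u, |t - s| < β.rOut → |u - s'| < β.rOut → |K t u - K s s'| ≤ η) :
    |(∫ t in Icc (-a) a, (∫ u in Icc (-a) a, K t u * β.normed volume (u - s')) * β.normed volume (t - s))
      - K s s'| ≤ η := by
  have hρc := continuous_normed_sub β s
  have hone := setIntegral_normed_sub (a := a) β hs
  have hKi := continuous_innerIntK (a := a) hK (continuous_normed_sub β s')
  have hI1 : IntegrableOn (fun t => (∫ u in Icc (-a) a, K t u * β.normed volume (u - s'))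
      * β.normed volume (t - s)) (Icc (-a) a) := (hKi.mul hρc).integrableOn_Icc
  have hI2 : IntegrableOn (fun t => K s s' * β.normed volume (t - s)) (Icc (-a) a) :=
    (continuous_const.mul hρc).integrableOn_Icc
  have hc : K s s' = ∫ t in Icc (-a) a, K s s' * β.normed volume (t - s) := by
    rw [integral_const_mul, hone, mul_one]
  rw [hc, ← integral_sub hI1 hI2]
  have hbound : ∀ t, ‖(∫ u in Icc (-a) a, K t u * β.normed volume (u - s')) * β.normed volume (t - s)
      - K s s' * β.normed volume (t - s)‖ ≤ η * β.normed volume (t - s) := by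
    intro t
    rw [← sub_mul, norm_mul, Real.norm_eq_abs, Real.norm_eq_abs, abs_of_nonneg (β.nonneg_normed _)]
    by_cases ht : |t - s| < β.rOut
    · exact mul_le_mul_of_nonneg_right (abs_innerIntK_sub_le hK β hs' (fun u hu => hKη t u ht hu))
        (β.nonneg_normed _)
    · rw [normed_sub_eq_zero β (not_lt.1 ht), mul_zero, mul_zero]
  calc |∫ t in Icc (-a) a, ((∫ u in Icc (-a) a, K t u * β.normed volume (u - s')) * β.normed volume (t - s)
          - K s s' * β.normed volume (t - s))|
      ≤ ∫ t in Icc (-a) a, η * β.normed volume (t - s) := by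
        rw [← Real.norm_eq_abs]
        exact norm_integral_le_of_norm_le ((continuous_const.mul hρc).integrableOn_Icc)
          (Eventually.of_forall hbound)
    _ = η := by rw [integral_const_mul, hone, mul_one]

/-! ## §4 Positivity on mean-zero test functions ⟹ positivity on zero-sum configurations -/

/-- **Comb theorem (generic kernel).** Let `K` be jointly continuous. If the real double integral
`D_K(φ, φ) = ∫∫ K(t,u) φ(u) φ(t)` is non-negative for every REAL mean-zero test function `φ ∈ 𝔈₀(a)`, then for every
finite zero-sum system of real weights `wᵢ` at points `|sᵢ| < a`: `0 ≤ Σᵢⱼ wᵢ wⱼ K(sᵢ, sⱼ)`. (Mollified combs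
`Σ wᵢ ρ_ε(· − sᵢ) ∈ 𝔈₀(a)`, bilinearity, and uniform continuity of `K` on `[−a,a]²`.)
[cite: Suzuki2023, (1.5) and (1.11) (the passage from the form on 𝔈₀(a) to configurations)] -/
theorem sum_sum_mul_mul_nonneg_of_forall_comb (hK : Continuous fun p : ℝ × ℝ => K p.1 p.2)
    (hpos : ∀ φ : ℝ → ℝ, (fun u => ((φ u : ℝ) : ℂ)) ∈ screwTestC0 a →
      0 ≤ ∫ t in Icc (-a) a, (∫ u in Icc (-a) a, K t u * φ u) * φ t)
    {N : ℕ} (s w : Fin N → ℝ) (hs : ∀ i, |s i| < a) (hw : ∑ i, w i = 0) :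
    0 ≤ ∑ i, ∑ j, w i * w j * K (s i) (s j) := by
  rcases Nat.eq_zero_or_pos N with hN | hN
  · subst hN; simp
  -- room `ε₀` between the configuration and the window edge
  haveI : Nonempty (Fin N) := Fin.pos_iff_nonempty.1 hN
  obtain ⟨i₀, -, hi₀⟩ := Finset.exists_max_image Finset.univ (fun i => |s i|) Finset.univ_nonempty
  set ε₀ : ℝ := a - |s i₀| with hε₀def
  have hε₀ : 0 < ε₀ := by have := hs i₀; linarith
  have hroom : ∀ i, |s i| + ε₀ ≤ a := fun i => by have := hi₀ i (Finset.mem_univ _); linarith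
  refine le_of_forall_pos_le_add fun δ hδ => ?_
  set C : ℝ := ∑ i, ∑ j, |w i| * |w j| with hCdef
  have hC : 0 ≤ C := Finset.sum_nonneg fun i _ => Finset.sum_nonneg fun j _ => by positivity
  set η : ℝ := δ / (C + 1) with hηdef
  have hη : 0 < η := by positivity
  have hηC : η * C ≤ δ := by
    rw [hηdef, div_mul_eq_mul_div, div_le_iff₀ (by positivity)]
    nlinarith
  have hUC := (isCompact_Icc.prod isCompact_Icc : IsCompact (Icc (-a) a ×ˢ Icc (-a) a))
    |>.uniformContinuousOn_of_continuous hK.continuousOn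
  rw [Metric.uniformContinuousOn_iff] at hUC
  obtain ⟨θ, hθ, hθ'⟩ := hUC η hη
  set ε : ℝ := min θ ε₀ / 2 with hεdef
  have hε : 0 < ε := by positivity
  have hεθ : ε < θ := by have := min_le_left θ ε₀; rw [hεdef]; linarith
  have hεε₀ : ε ≤ ε₀ := by have := min_le_right θ ε₀; rw [hεdef]; linarith [le_min hθ.le hε₀.le]
  let β : ContDiffBump (0 : ℝ) := ⟨ε / 2, ε, by positivity, by linarith⟩
  have hβ : β.rOut = ε := rfl
  have hsβ : ∀ i, |s i| + β.rOut ≤ a := fun i => by rw [hβ]; linarith [hroom i]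
  have hKη : ∀ i j t u, |t - s i| < β.rOut → |u - s j| < β.rOut → |K t u - K (s i) (s j)| ≤ η := by
    intro i j t u ht hu
    rw [hβ] at ht hu
    have hmem : ∀ {x c : ℝ}, |x - c| < ε → |c| + β.rOut ≤ a → x ∈ Icc (-a) a := by
      intro x c hx hc
      rw [hβ] at hc
      have h1 : |x| ≤ a := by have := abs_sub_abs_le_abs_sub x c; linarith
      exact ⟨(abs_le.1 h1).1, (abs_le.1 h1).2⟩
    have hsi : ∀ k, s k ∈ Icc (-a) a := fun k => ⟨(abs_le.1 (hs k).le).1, (abs_le.1 (hs k).le).2⟩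
    have h := hθ' (t, u) ⟨hmem ht (hsβ i), hmem hu (hsβ j)⟩ (s i, s j) ⟨hsi i, hsi j⟩ ?_
    · exact (Real.dist_eq _ _ ▸ h).le
    · rw [Prod.dist_eq, Real.dist_eq, Real.dist_eq]
      exact max_lt (ht.trans hεθ) (hu.trans hεθ)
  have hmem := comb_mem_screwTestC0 (a := a) s w β hsβ hw
  have h1 := hpos (comb s w β) hmem
  have hρc : ∀ i, Continuous fun u => β.normed volume (u - s i) := fun i => continuous_normed_sub β (s i)
  have h2 : (∫ t in Icc (-a) a, (∫ u in Icc (-a) a, K t u * comb s w β u) * comb s w β t) =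
      ∑ j, w j * ∑ i, w i * ∫ t in Icc (-a) a, (∫ u in Icc (-a) a, K t u * β.normed volume (u - s j))
        * β.normed volume (t - s i) := by
    have e1 : (∫ t in Icc (-a) a, (∫ u in Icc (-a) a, K t u * comb s w β u) * comb s w β t) =
        ∑ j, w j * ∫ t in Icc (-a) a, (∫ u in Icc (-a) a, K t u * β.normed volume (u - s j)) * comb s w β t :=
      doubleIntK_sum_left hK Finset.univ w hρc (continuous_comb s w β)
    rw [e1]
    refine Finset.sum_congr rfl fun j _ => ?_
    have e2 : (∫ t in Icc (-a) a, (∫ u in Icc (-a) a, K t u * β.normed volume (u - s j)) * comb s w β t) =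
        ∑ i, w i * ∫ t in Icc (-a) a, (∫ u in Icc (-a) a, K t u * β.normed volume (u - s j))
          * β.normed volume (t - s i) :=
      doubleIntK_sum_right hK Finset.univ w (hρc j) hρc
    rw [e2]
  have h3 : |(∑ j, w j * ∑ i, w i * ∫ t in Icc (-a) a, (∫ u in Icc (-a) a, K t u * β.normed volume (u - s j))
        * β.normed volume (t - s i))
      - ∑ j, w j * ∑ i, w i * K (s i) (s j)| ≤ η * C := by
    calc |(∑ j, w j * ∑ i, w i * ∫ t in Icc (-a) a, (∫ u in Icc (-a) a, K t u * β.normed volume (u - s j))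
            * β.normed volume (t - s i))
          - ∑ j, w j * ∑ i, w i * K (s i) (s j)|
        = |∑ j, w j * ∑ i, w i * ((∫ t in Icc (-a) a, (∫ u in Icc (-a) a, K t u * β.normed volume (u - s j))
            * β.normed volume (t - s i)) - K (s i) (s j))| := by
          congr 1
          rw [← Finset.sum_sub_distrib]
          refine Finset.sum_congr rfl fun j _ => ?_
          rw [← mul_sub, ← Finset.sum_sub_distrib]
          congr 1
          refine Finset.sum_congr rfl fun i _ => ?_
          ring
      _ ≤ ∑ j, |w j * ∑ i, w i * ((∫ t in Icc (-a) a, (∫ u in Icc (-a) a, K t u * β.normed volume (u - s j))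
            * β.normed volume (t - s i)) - K (s i) (s j))| :=
          Finset.abs_sum_le_sum_abs _ _
      _ ≤ ∑ j, |w j| * ∑ i, |w i| * η := by
          refine Finset.sum_le_sum fun j _ => ?_
          rw [abs_mul]
          refine mul_le_mul_of_nonneg_left ?_ (abs_nonneg _)
          refine (Finset.abs_sum_le_sum_abs _ _).trans (Finset.sum_le_sum fun i _ => ?_)
          rw [abs_mul]
          exact mul_le_mul_of_nonneg_left
            (abs_doubleIntK_sub_le (a := a) hK β (hsβ i) (hsβ j) (hKη i j)) (abs_nonneg _)
      _ = η * C := by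
          rw [hCdef, Finset.mul_sum]
          refine Finset.sum_congr rfl fun j _ => ?_
          rw [Finset.mul_sum, Finset.mul_sum]
          refine Finset.sum_congr rfl fun i _ => ?_
          ring
  -- the target double sum, re-indexed
  have h5 : ∑ i, ∑ j, w i * w j * K (s i) (s j) = ∑ j, w j * ∑ i, w i * K (s i) (s j) := by
    rw [Finset.sum_comm]
    refine Finset.sum_congr rfl fun j _ => ?_
    rw [Finset.mul_sum]
    exact Finset.sum_congr rfl fun i _ => by ring
  rw [h5]
  rw [h2] at h1
  have h6 := (abs_sub_le_iff.1 h3).1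
  linarith

/-! ## §5 Kreĭn kernels: the zero-sum condition is removed by the node `0` -/

/-- The Kreĭn kernel of a continuous function is jointly continuous. [folklore] -/
theorem continuous_kreinKernel_real {F : ℝ → ℝ} (hF : Continuous F) :
    Continuous fun p : ℝ × ℝ => F p.1 + F p.2 - F (p.1 - p.2) :=
  ((hF.comp continuous_fst).add (hF.comp continuous_snd)).sub (hF.comp (continuous_fst.sub continuous_snd))

/-- **Kreĭn kernels (real form).** Let `F` be continuous, even, with `F 0 = 0`. If
`D_{K_F}(φ, φ) ≥ 0` for every real `φ ∈ 𝔈₀(a)`, then `K_F(t,u) = F(t) + F(u) − F(t−u)` is positive semidefinite on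
finite configurations in the OPEN window `(−a, a)` (augment a configuration by the node `0`, where `K_F` vanishes, to
reach a zero-sum system; `krein_sum_eq_cons`). [cite: BergChristensenRessel1984, Ch. 3 §1 Lemma 2.1 (PDF p. 74) — the augmentation by a base point] -/
theorem krein_psd_Ioo_of_forall_comb {F : ℝ → ℝ} (hF : Continuous F) (hFe : ∀ t, F (-t) = F t) (hF0 : F 0 = 0)
    (hpos : ∀ φ : ℝ → ℝ, (fun u => ((φ u : ℝ) : ℂ)) ∈ screwTestC0 a →
      0 ≤ ∫ t in Icc (-a) a, (∫ u in Icc (-a) a, (F t + F u - F (t - u)) * φ u) * φ t) :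
    IsPosSemidefKernelOn (kreinKernel F) (Ioo (-a) a) := by
  rw [krein_psd_iff_real hFe]
  intro N t x ht
  rcases Nat.eq_zero_or_pos N with hN | hN
  · subst hN; simp
  have ha : 0 < a := by
    have h := ht ⟨0, hN⟩
    linarith [h.1, h.2]
  -- augmented zero-sum system
  set s : Fin (N + 1) → ℝ := Fin.cons 0 t with hsdef
  set w : Fin (N + 1) → ℝ := Fin.cons (-∑ i, x i) x with hwdef
  have hs : ∀ i, |s i| < a := by
    intro i
    refine Fin.cases ?_ (fun i => ?_) i
    · simp [hsdef, ha]
    · simpa [hsdef] using abs_lt.2 (ht i)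
  have hw : ∑ i, w i = 0 := by simp [hwdef, Fin.sum_univ_succ]
  have key := sum_sum_mul_mul_nonneg_of_forall_comb (K := fun t u => F t + F u - F (t - u))
    (continuous_kreinKernel_real hF) hpos s w hs hw
  rw [krein_sum_eq_cons hFe hF0 t x]
  refine key.trans_eq (Finset.sum_congr rfl fun i _ => Finset.sum_congr rfl fun j _ => ?_)
  simp only [hsdef, hwdef]
  ring

/-- **Kreĭn kernels (complex form).** Let `F` be continuous, even, with `F 0 = 0`. If the hermitian form
`∫_{(−a,a)}∫_{(−a,a)} K_F(t,u) φ(u) conj φ(t) du dt` has non-negative real part for every `φ ∈ 𝔈₀(a)`, then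
`kreinKernel F` is positive semidefinite on finite configurations in `(−a, a)`. [cite: Suzuki2023, (1.5) and (1.11)] -/
theorem krein_psd_Ioo_of_forall_re_nonneg {F : ℝ → ℝ} (hF : Continuous F) (hFe : ∀ t, F (-t) = F t)
    (hF0 : F 0 = 0)
    (hpos : ∀ φ : ℝ → ℂ, φ ∈ screwTestC0 a →
      0 ≤ (∫ t in Ioo (-a) a, ∫ u in Ioo (-a) a, kreinKernel F t u * φ u * conj (φ t)).re) :
    IsPosSemidefKernelOn (kreinKernel F) (Ioo (-a) a) := by
  refine krein_psd_Ioo_of_forall_comb hF hFe hF0 fun φ hφ => ?_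
  rw [← re_setIntegral_setIntegral_kreinKernel_ofReal F φ]
  exact hpos _ hφ

end Summit.RiemannHypothesis.RiemannHypothesis.Theorems.KreinFormComb

end
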